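import Summits.RiemannHypothesis.RiemannHypothesis.Theorems.HandoffDecomposition
import Summits.RiemannHypothesis.RiemannHypothesis.Theorems.HandoffAnalytic
import HarnessLib

/-!
# HANDOFF — slot E-1 typed: the wall offset `δ*(q)`, the THRESHOLD-margin law `MARGIN(m)` and the ENERGY-margin law, with their exact logical status (cell rh-explicit, TRACK «HANDOFF», seat theory-2)

HONEST FRAMING. Nothing here proves or approaches RH. HANDOFF-STATEMENT.md §E lists the «slots for the structural
conjectures»; its status line says that of these ONLY E-1, `MARGIN(m)` with `m ≥ 0`, IMPLIES RH (and is `≥ RH`: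
equal to RH for `m = 0`, strictly stronger as far as anyone knows for `m > 0`), while every instance `q` of it is an
RH-FREE window-positivity statement about the finite-place form `Q_{S_q}` — certifiable / refutable prime by prime
(conj-1's MARGIN-LAW.md supplies the candidate `m`, FITTED/MODEL). That slot was markdown only. This file TYPES it:

* `wallOffset q = δ*(q) := a*(S_q) − (log q)/2` (`a* = weilSemilocalThreshold`, `S_q = Nat.primesBelow q`), with
  `RH ↔ ∀ q prime, 0 ≤ δ*(q)` and `H(q) ↔ 0 ≤ δ*(q⁺)` (re-statements of the tree's threshold theorems);
* `HandoffMargin m` (E-1, THRESHOLD margin): `∀ q prime, (log q)/2 + m q ≤ a*(S_q)`, i.e. `m q ≤ δ*(q)`; PROVED: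
  `HandoffMargin 0 ↔ RH`, `(∀ q, 0 ≤ m q) → HandoffMargin m → RH`, monotonicity in `m`, and the INSTANCE form
  `HandoffMargin m ↔ ∀ q prime, WeilSemilocalPositivityOn S_q ((log q)/2 + m q)` (each instance RH-free);
* `HandoffEnergyMargin m` (the ADDITIVE margin «contribution − deficit ≥ m‖g‖₂²» = a law for Weil's ground energy at the
  window ends, `m q ≤ ε((log q⁺)/2)` — the Route-III object, numerically `10^{−16…−97}`, HANDOFF-STATEMENT §E-1 note / §H.5):
  `HandoffEnergyMargin 0 ↔ RH`, `m ≥ 0 → … → RH`, and its per-test-function form.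

So the human's question «a structure conjecture that would yield RH» has, in this track, exactly these typed shapes with
`m ≥ 0` — both AT LEAST RH-strength as families, both falsifiable instance by instance; nothing here says either holds.

References (as printed): H. Yoshida, Adv. Stud. Pure Math. 21 (1992) Prop. 6 p. 320 (the threshold `a₀`; here with the
primes restricted to `S`, `Yoshida1992HermitianForms`); E. Bombieri, Rend. Mat. Acc. Lincei (9) 11 (2000) Thm 2 p. 193, §4
Problem 2 p. 194 (`Bombieri2000Weil`); A. Connes, C. Consani, Enseign. Math. 69 (2023) §2.2–2.4 (`ConnesConsani2023`).
-/

set_option linter.dupNamespace false  -- the mandated namespace repeats `RiemannHypothesis`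

noncomputable section

open Set Filter Complex MeasureTheory Literature.NumberTheory.LFunctions
open Summit.RiemannHypothesis.RiemannHypothesis.Theorems.Handoff (deficit contribution ConsecutivePrimes)
open Summit.RiemannHypothesis.RiemannHypothesis.Theorems.HandoffDecomposition
open Summit.RiemannHypothesis.RiemannHypothesis.Theorems.MotivicDoor.SemilocalThreshold
open scoped Real ComplexConjugate

namespace Summit.RiemannHypothesis.RiemannHypothesis.Theorems.HandoffMarginLaw

variable {g : ℝ → ℂ} {m m' : ℕ → ℝ} {q : ℕ}

/-! ## §1  The wall offset -/

/-- **The wall offset** `δ*(q) := a*(S_q) − (log q)/2` of a prime `q` (`S_q = {p < q}`): by how much the window on which the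
`{p < q}`-semilocal form is positive extends beyond the point where the prime `q` becomes visible (the cell's C-I object;
certified positive for every prime `q ≤ 59`). [this track, HANDOFF-STATEMENT §B.1; object = Yoshida1992HermitianForms Prop. 6 threshold with the primes restricted to S_q] -/
def wallOffset (q : ℕ) : ℝ := weilSemilocalThreshold (Nat.primesBelow q) - Real.log q / 2

/-- `0 ≤ δ*(q) ↔ (log q)/2 ≤ a*(S_q) ↔ WeilSemilocalPositivityOn S_q ((log q)/2)`. [folklore] -/
theorem wallOffset_nonneg_iff : 0 ≤ wallOffset q ↔ WeilSemilocalPositivityOn (Nat.primesBelow q) (Real.log q / 2) := by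
  rw [wallOffset, sub_nonneg, weilSemilocalPositivityOn_iff_le_weilSemilocalThreshold]

/-- **`H(q) ↔ 0 ≤ δ*(q⁺)`** (`q` prime): the handoff condition of `q` is the non-negativity of the NEXT prime's wall offset.
[cite: Yoshida1992HermitianForms, Prop. 6 (p. 320), with the primes restricted to S] -/
theorem handoffH_iff_wallOffset_nonneg (hq : q.Prime) : HandoffH q ↔ 0 ≤ wallOffset (nextPrime q) := by
  rw [handoffH_iff_wallOffset hq, wallOffset, sub_nonneg]

/-- **`RH ↔ ∀ q prime, 0 ≤ δ*(q)`** (the threshold form, HANDOFF-STATEMENT §B.4). [cite: Yoshida1992HermitianForms, Prop. 6; Bombieri2000Weil Thm 2] -/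
theorem riemannHypothesis_iff_forall_wallOffset_nonneg :
    Summit.RiemannHypothesis ↔ ∀ q : ℕ, q.Prime → 0 ≤ wallOffset q := by
  rw [riemannHypothesis_iff_forall_log_half_le_weilSemilocalThreshold]
  simp only [wallOffset, sub_nonneg]

/-! ## §2  Slot E-1: the THRESHOLD-margin law `MARGIN(m)` -/

/-- **`MARGIN(m)`** (HANDOFF-STATEMENT §E-1): for a function `m` on the primes, `∀ q prime, (log q)/2 + m(q) ≤ a*(S_q)` —
the `{p < q}`-form stays positive a margin `m(q)` BEYOND the point where `q` becomes visible. A statement of THIS track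
(conj-1's MARGIN-LAW proposes `m`), not a literature fact; with `m ≥ 0` it implies RH (`riemannHypothesis_of_handoffMargin`)
and is at least RH-strength. [this track, HANDOFF-STATEMENT §E-1 / MARGIN-LAW.md] -/
def HandoffMargin (m : ℕ → ℝ) : Prop :=
  ∀ q : ℕ, q.Prime → Real.log q / 2 + m q ≤ weilSemilocalThreshold (Nat.primesBelow q)

/-- `MARGIN(m) ↔ ∀ q prime, m(q) ≤ δ*(q)`. [folklore] -/
theorem handoffMargin_iff_forall_le_wallOffset : HandoffMargin m ↔ ∀ q : ℕ, q.Prime → m q ≤ wallOffset q := by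
  refine forall₂_congr fun q _ ↦ ?_
  rw [wallOffset, le_sub_iff_add_le, add_comm]

/-- **Each instance is an RH-free window statement about a finite-place form**:
`MARGIN(m) ↔ ∀ q prime, WeilSemilocalPositivityOn S_q ((log q)/2 + m(q))`. [folklore] -/
theorem handoffMargin_iff_forall_weilSemilocalPositivityOn :
    HandoffMargin m ↔ ∀ q : ℕ, q.Prime → WeilSemilocalPositivityOn (Nat.primesBelow q) (Real.log q / 2 + m q) := by
  refine forall₂_congr fun q _ ↦ ?_
  rw [weilSemilocalPositivityOn_iff_le_weilSemilocalThreshold]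

/-- Monotonicity: a larger margin law implies a smaller one. [folklore] -/
theorem HandoffMargin.mono (h : HandoffMargin m) (hle : ∀ q : ℕ, q.Prime → m' q ≤ m q) : HandoffMargin m' := by
  intro q hq
  have h1 := hle q hq
  have h2 := h q hq
  linarith

/-- **`MARGIN(0) ↔ RH`.** [cite: Yoshida1992HermitianForms, Prop. 6; Bombieri2000Weil Thm 2] -/
theorem handoffMargin_zero_iff : HandoffMargin (fun _ ↦ 0) ↔ Summit.RiemannHypothesis := by
  rw [riemannHypothesis_iff_forall_log_half_le_weilSemilocalThreshold]
  simp only [HandoffMargin, add_zero]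

/-- **A non-negative margin law implies RH** (`m ≥ 0 ∧ MARGIN(m) ⟹ RH`; the converse of this implication is NOT claimed for `m > 0`). [this track] -/
theorem riemannHypothesis_of_handoffMargin (hm : ∀ q : ℕ, q.Prime → 0 ≤ m q) (h : HandoffMargin m) :
    Summit.RiemannHypothesis :=
  handoffMargin_zero_iff.1 (h.mono hm)

/-- RH gives every NON-POSITIVE margin law (and nothing more is claimed). [cite: Bombieri2000Weil, Thm 2 (⇒)] -/
theorem handoffMargin_of_riemannHypothesis (hRH : Summit.RiemannHypothesis) (hm : ∀ q : ℕ, q.Prime → m q ≤ 0) :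
    HandoffMargin m :=
  (handoffMargin_zero_iff.2 hRH).mono hm

/-- The instance at `q⁺` with zero margin IS `H(q)`: `H(q) ↔ (log q⁺)/2 + 0 ≤ a*(S_{q⁺})`. [folklore] -/
theorem handoffH_iff_margin_instance (hq : q.Prime) :
    HandoffH q ↔ Real.log (nextPrime q) / 2 + 0 ≤ weilSemilocalThreshold (Nat.primesBelow (nextPrime q)) := by
  rw [add_zero, handoffH_iff_wallOffset hq]

/-! ## §3  The ENERGY-margin law (the additive margin `contribution − deficit ≥ m‖g‖₂²`) -/

/-- **The energy-margin law** `EMARGIN(m) : ∀ q prime, m(q) ≤ ε((log q⁺)/2)` (`ε = weilGroundEnergy`, Weil's ground energy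
at the END of the window of `q`): the additive reading of «contribution − deficit ≥ m» (HANDOFF-STATEMENT §E-1, note; conj-1's
`m_E`). A statement of THIS track, not a literature fact. [this track, HANDOFF-STATEMENT §E-1 / §H.5] -/
def HandoffEnergyMargin (m : ℕ → ℝ) : Prop :=
  ∀ q : ℕ, q.Prime → m q ≤ weilGroundEnergy (Real.log (nextPrime q) / 2)

/-- **`EMARGIN(0) ↔ RH`** (`H(q) ↔ 0 ≤ ε((log q⁺)/2)` for every prime). [cite: Bombieri2000Weil, §4 Problem 2 and Thm 2] -/
theorem handoffEnergyMargin_zero_iff : HandoffEnergyMargin (fun _ ↦ 0) ↔ Summit.RiemannHypothesis := by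
  rw [riemannHypothesis_iff_forall_handoffH]
  refine forall₂_congr fun q hq ↦ ?_
  rw [HandoffH, HandoffAnalytic.handoffH_iff_weilGroundEnergy_nonneg (consecutivePrimes_nextPrime hq)]

/-- Monotonicity in `m`. [folklore] -/
theorem HandoffEnergyMargin.mono (h : HandoffEnergyMargin m) (hle : ∀ q : ℕ, q.Prime → m' q ≤ m q) :
    HandoffEnergyMargin m' :=
  fun q hq ↦ (hle q hq).trans (h q hq)

/-- **A non-negative energy-margin law implies RH.** [this track] -/
theorem riemannHypothesis_of_handoffEnergyMargin (hm : ∀ q : ℕ, q.Prime → 0 ≤ m q) (h : HandoffEnergyMargin m) :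
    Summit.RiemannHypothesis :=
  handoffEnergyMargin_zero_iff.1 (h.mono hm)

/-- **Per test function**: `EMARGIN(m)` at `q` says `deficit_q(g) + m(q)‖g‖₂² ≤ contribution_q(g)` for every Weil test function
`g ∈ C((log q⁺)/2)` — the directive's «contribution − deficit ≥ m» literally. [cite: Bombieri2000Weil, §4 Problem 2 (λ = T[f*f̄*]/‖f‖²)] -/
theorem handoffEnergyMargin_iff_pointwise :
    HandoffEnergyMargin m ↔ ∀ q : ℕ, q.Prime → ∀ g : ℝ → ℂ, IsWeilTest g →
      tsupport g ⊆ Icc (-(Real.log (nextPrime q) / 2)) (Real.log (nextPrime q) / 2) →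
        deficit q g + m q * ∫ t, ‖g t‖ ^ 2 ≤ contribution q g := by
  refine forall₂_congr fun q hq ↦ ?_
  have hc := consecutivePrimes_nextPrime hq
  set b : ℝ := Real.log (nextPrime q) / 2 with hb
  have hb0 : 0 < b := hc.log_half_pos
  constructor
  · intro hm g hg hs
    have h1 : weilGroundEnergy b * ∫ t, ‖g t‖ ^ 2 ≤ (weilQuadratic g).re := by
      rw [weilGroundEnergy_eq_sInf]
      exact sInf_weilWindowSphereValues_mul_le_re hg hs fun _ _ ↦ trivial
    have hN : 0 ≤ ∫ t, ‖g t‖ ^ 2 := integral_nonneg fun _ ↦ by positivity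
    have h2 : m q * ∫ t, ‖g t‖ ^ 2 ≤ weilGroundEnergy b * ∫ t, ‖g t‖ ^ 2 :=
      mul_le_mul_of_nonneg_right hm hN
    rw [Handoff.re_weilQuadratic_eq_contribution_sub_deficit hc hg hs] at h1
    linarith
  · intro h
    rw [weilGroundEnergy_eq_sInf]
    refine le_sInf_weilWindowSphereValues (weilWindowSphereValues_top_nonempty hb0) fun g hg hs _ hn ↦ ?_
    have := h g hg hs
    rw [hn, mul_one, Handoff.re_weilQuadratic_eq_contribution_sub_deficit hc hg hs] at *
    linarith

end Summit.RiemannHypothesis.RiemannHypothesis.Theorems.HandoffMarginLaw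

end
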